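import Summits.BirchSwinnertonDyer.BirchSwinnertonDyer.Theorems.BiquadraticEisensteinDescentDeuringOfCore
import Summits.BirchSwinnertonDyer.BirchSwinnertonDyer.Theorems.BiquadraticEisensteinDescentDeuringCoreRow
import Literature.NumberTheory.EllipticCurves.QuarticTwistDeuringCore
import Literature.NumberTheory.EllipticCurves.DeuringHeckeContinuationFiveRows
import Literature.NumberTheory.EllipticCurves.ComplexMultiplicationShaRubinRationalCMProofs
import Literature.NumberTheory.EllipticCurves.LFunctionSmulProofs
import HarnessLib

set_option autoImplicit false

/-!
# BED route, «Deuring-ψ lane»: Deuring's theorem for EVERY curve with `j = 1728` (the quartic-twist row `y² = x³ − Dx`,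
# CM by `ℤ[i]`), all five clauses, UNCONDITIONALLY

Route `BiquadraticEisensteinDescent` of `Summits/BirchSwinnertonDyer` (crux `EisensteinHeartFlatCMInertBadKPrime`,
stmt-BirchSwinnertonDyer-21341; cell `bsd-wall`, seats w4 (spine: `deuring_of_core_at`, the datum `QuarticTwistDatum.*`) and
w3 (ramification witnesses, CORE `QuarticTwist.exists_heckeCharacter_pinned`, this assembly)). THEOREMS ONLY.  The eighth of
the nine rows of the named fact `Deuring_exists_heckeCharacter_of_maximalCM` (Silverman *ATAEC* II Thm. 9.2 + Thm. 10.5):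

* `core_of_j_eq_1728` — for every elliptic `W/ℚ` with `W.j = 1728` and every `K` with `IsCMFieldOfJ K W.j` (`K = ℚ(i)`,
  `QuarticTwist.isCyclotomicExtension_four_of_sq_eq_neg_four`): a Hecke character of type `(1, 0)` with `L(s, ψ) = L(W, s)`
  on `re s > 3/2`.  `W ≅ y² = x³ + Ax` (`Rubin1987.exists_smul_eq_of_j_eq_1728`), `A = n q⁴` with `n ∈ ℤ` fourth-power-free
  (`DeuringHecke.rat_exists_eq_intCast_mul_pow`), `≅ y² = x³ + nx = E_{−n}` (`DeuringHecke.smul_quartic_model`), `L`-series are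
  isomorphism invariants (`LSeries_smul`), and Ireland–Rosen's Theorem 18.7 in CORE form (`QuarticTwist.exists_heckeCharacter_pinned`);
* ★★★ `deuring_of_j_eq_1728` — all five clauses for every globally minimal `W` with `j(W) = 1728`, every CM field `K` of `W`,
  every `c ≠ 1` (`deuring_of_core_at`).

BSD is not proved by any of this; the named fact itself still waits on the row `j = 0`.
References: [IrelandRosen1982] Ch. 18 §6 Thm. 7; [SilvermanATAEC1994] II Thm. 9.2, Thm. 10.5 (b), Ex. 2.30–2.32;
[SilvermanAEC2009] X.5 Prop. 5.4.
-/

set_option linter.dupNamespace false -- `Summit.BirchSwinnertonDyer.BirchSwinnertonDyer.Theorems.…` (summit = sub)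

noncomputable section

namespace Summit.BirchSwinnertonDyer.BirchSwinnertonDyer.Theorems.BiquadraticEisensteinDescentDeuringOfCore

open scoped NumberField
open NumberField IsDedekindDomain WeierstrassCurve
  Literature.NumberTheory.GaloisRepresentations Literature.NumberTheory.EllipticCurves

/-- **The CORE of Deuring's theorem for EVERY elliptic curve over `ℚ` with `j = 1728`** and every `K` with `IsCMFieldOfJ K 1728`
(`= ℚ(i)`): a Hecke character of `K` of infinity type `(1, 0)` with `L(s, ψ) = L(W, s)` on `re s > 3/2`.  `W ≅ y² = x³ + Ax`
(`Rubin1987.exists_smul_eq_of_j_eq_1728`), `A = n q⁴` with `n ∈ ℤ` fourth-power-free (`DeuringHecke.rat_exists_eq_intCast_mul_pow`),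
`y² = x³ + n q⁴ x ≅ y² = x³ + nx = E_{−n}` (`DeuringHecke.smul_quartic_model`), `L`-series are isomorphism invariants
(`LSeries_smul`), and the CORE for `E_{−n}` is `QuarticTwist.exists_heckeCharacter_pinned` (Ireland–Rosen Thm. 18.7).
[cite: IrelandRosen1982, Ch. 18 §6, Theorem 7] [cite: SilvermanATAEC1994, Ch. II Thm. 9.2 (a), Thm. 10.5 (b)] -/
theorem core_of_j_eq_1728 (W : WeierstrassCurve ℚ) [W.IsElliptic] (hjW : W.j = 1728)
    (K : Type) [Field K] [NumberField K] (hK : IsCMFieldOfJ K W.j) :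
    ∃ ψ : HeckeCharacter K, ψ.HasInfinityType (fun _ => 1) (fun _ => 0) ∧
      ∀ s : ℂ, 3 / 2 < s.re → heckeLFunction ψ s = W.LSeries s := by
  -- `K = ℚ(i)`
  obtain ⟨θ, hθ⟩ := hK.2
  rw [hjW] at hθ
  have hθ' : θ ^ 2 = -4 := by rw [hθ]; norm_num [cmFieldDiscr]
  haveI := QuarticTwist.isCyclotomicExtension_four_of_sq_eq_neg_four hK.1 hθ'
  -- `W ≅ y² = x³ + Ax ≅ y² = x³ + nx`, `n` fourth-power-free
  obtain ⟨A, C, hA, hC⟩ := Rubin1987.exists_smul_eq_of_j_eq_1728 hjW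
  obtain ⟨n, q, hn, hq, hAeq, hfree⟩ := DeuringHecke.rat_exists_eq_intCast_mul_pow 4 (by norm_num) A hA
  have hcore := QuarticTwist.exists_heckeCharacter_pinned (D := -n) (neg_ne_zero.mpr hn)
    (fun p hp h4 => hfree p hp (dvd_neg.mp h4)) K
  have hmodel : (⟨0, 0, 0, -((-n : ℤ) : ℚ), 0⟩ : WeierstrassCurve ℚ) = ⟨0, 0, 0, (n : ℚ), 0⟩ := by
    push_cast; rw [neg_neg]
  rw [hmodel] at hcore
  -- `L(W, s) = L(E_{-n}, s)`
  haveI hE1 : (C • W).IsElliptic := by infer_instance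
  haveI hE2 : ((⟨0, 0, 0, (n : ℚ) * q ^ 4, 0⟩ : WeierstrassCurve ℚ)).IsElliptic := by rw [← hAeq, ← hC]; exact hE1
  have hL : W.LSeries = ((⟨0, 0, 0, (n : ℚ), 0⟩ : WeierstrassCurve ℚ)).LSeries := by
    rw [← DeuringHecke.smul_quartic_model (A := (n : ℚ)) hq, WeierstrassCurve.LSeries_smul, ← hAeq, ← hC,
      WeierstrassCurve.LSeries_smul]
  exact core_of_LSeries_eq hL hcore

/-- ★★★ **Deuring's theorem (all five clauses of `Deuring_exists_heckeCharacter_of_maximalCM`) for every globally minimal `W/ℚ`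
with `j(W) = 1728`**, UNCONDITIONALLY (`core_of_j_eq_1728` + `deuring_of_core_at`): CM by `ℤ[i]`, the quartic-twist family
`y² = x³ − Dx`. [cite: IrelandRosen1982, Ch. 18 §6, Theorem 7] [cite: SilvermanATAEC1994, Ch. II Thm. 9.2, Cor. 10.4.1, Thm. 10.5 (b), Ex. 2.30–2.32] -/
theorem deuring_of_j_eq_1728 (W : WeierstrassCurve ℚ) [W.IsElliptic] [W.IsGloballyMinimal] (hjW : W.j = 1728)
    (K : Type) [Field K] [NumberField K] (hK : IsCMFieldOfJ K W.j) (c : K ≃ₐ[ℚ] K) (hc : c ≠ 1) :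
    ∃ ψ : HeckeCharacter K,
      ψ.HasInfinityType (fun _ ↦ 1) (fun _ ↦ 0) ∧
      IsHeckeConjEquivariant c ψ ∧
      (∀ w : HeightOneSpectrum (𝓞 K), ψ.IsUnramifiedAt w ↔ (W.baseChange K).HasGoodReductionAt w) ∧
      (∀ (p : ℕ) [Fact p.Prime], W.HasGoodReductionAtPrime p →
        ∀ w : HeightOneSpectrum (𝓞 K), (p : 𝓞 K) ∈ w.asIdeal →
          ψ.IsUnramifiedAt w ∧
          (c • w ≠ w →
            ψ.valueAtUniformizer w + ψ.valueAtUniformizer (c • w) = (W.frobeniusTrace p : ℂ) ∧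
            ψ.valueAtUniformizer w * ψ.valueAtUniformizer (c • w) = (p : ℂ)) ∧
          (c • w = w → W.frobeniusTrace p = 0 ∧ ψ.valueAtUniformizer w = -(p : ℂ))) ∧
      ∀ s : ℂ, 3 / 2 < s.re → heckeLFunction ψ s = W.LSeries s :=
  deuring_of_core_at W (by rw [hjW]; simp [maximalCMJInvariants]) K hK c hc (core_of_j_eq_1728 W hjW K hK)

end Summit.BirchSwinnertonDyer.BirchSwinnertonDyer.Theorems.BiquadraticEisensteinDescentDeuringOfCore

end
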